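import Summits.Ventures.HSemireg.WedgeHankelRecurrenceSignCount
import Summits.Ventures.HSemireg.WedgeHankelRecurrenceSignatureCauchyIndex

/-!
# Venture HSemireg — HERMITE'S INTERVAL COUNT BY HANKEL SIGNATURES: for `P` monic real with `deg P ≤ t + 1` and real numbers `α`, `β`, with `W = (X − α)(β − X)`,
# **`2·#{x ∈ roots_ℝ(P) | α < x < β} = Sign H_t(W²P′/P) + Sign H_t(WP′/P)`**, and when `P(α)P(β) ≠ 0` **`= #roots_ℝ(P) + Sign H_t(WP′/P) = Sign H_t(P′/P) + Sign H_t(WP′/P)`**; one-sided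
# counts `#{x > α}`, `#{x < α}` with `W = X − α`, `α − X`; and the dictionary with the tree's windowed Sturm–Tarski count: **`2·TaQ(1, P; α, β) = Sign H_t(P′/P) + Sign H_t(WP′/P)`**
# (Hermite 1853: the number of roots between two limits from the signatures of quadratic forms — here N153's sign-condition count with the test polynomial `W`)

HONEST FRAMING. Part of the Lean index of the computation cell `pub-hsemireg` (seat p10 gen 36, Sunday typer «UNIFORM-IN-n»).
LINEAR ALGEBRA OF HANKEL MATRICES AND REAL POLYNOMIALS ONLY (Mathlib's `sigPos` ∕ `sigNeg`; PROVED Literature `Algebra/Polynomial/SignDetermination` — `rootsIn`, `tarskiQuery_eq_taq`, `taq_one` —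
and `TarskiQuery` — `tarskiQuery` — IMPORTED through N153): no variety, no cohomology theory, no sheaf, no Ext group and no semiregularity map is constructed here; nothing here says that HC / HC_CM /
HC_AV holds; no Literature fact (unproved `Prop`) is declared or used.  Custodian versions as in `WedgeHankelSiegelIdeal` (1/3).
SOURCE OF THE ARGUMENT (cited): C. Hermite, *Remarques sur le théorème de M. Sturm*, C. R. Acad. Sci. Paris 36 (1853) 294–297, and *Sur l'extension du théorème de M. Sturm à un système
d'équations simultanées* (Œuvres III): the number of real roots of `P` in `(α, β)` is read from the signatures of Hermite's forms with the multiplier `(x − α)(β − x)`; S. Basu, R. Pollack, M.-F. Roy,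
*Algorithms in Real Algebraic Geometry* (2006) Prop. 2.65 ∕ Thm. 4.57 (the general sign-condition count, typed in N153; held text pp. 64–66, 129–131) and Notation 2.56 (`TaQ(Q, P; a, b)`).  Here:
N153 `two_mul_card_roots_filter_eval_pos_eq` with `Q := (X − C α)(C β − X)`, whose positivity set is `(α, β)`.
DEDUP DISCLOSURE (`rg` of the whole tree + Mathlib, 2026-09-01): the tree counts the roots of `P` in `(a, b)` by STURM sequences (Literature `CauchyIndex.sturm_general`, `TarskiQuery.tarski`, N129
`sigPos_sub_sigNeg_eq_signedRemVar_sub` for ALL roots) and N153 counts `#{Q > 0}` for a general `Q`; NO file states the interval ∕ half-line counts through Hankel signatures or equates `TaQ(1, P; α, β)`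
with a combination of Hankel signatures, nor a WINDOWED `Ind(Q/P; α, β)` ∕ `TaQ(Q, P; α, β)` by Hankel forms — that is this file.  14 names: 0 hits tree-wide.

WHAT IS IN THE TREE (or staged ahead).  N153: **`two_mul_card_roots_filter_eval_pos_eq`**, `two_mul_card_roots_filter_eval_neg_eq`, `sigPos_sub_sigNeg_hankelSq_dualSeq_sq_mul_derivative_eq`,
`card_roots_filter_eval_ne_zero_eq`; N129 `sigPos_sub_sigNeg_hankelSq_dualSeq_derivative_real` (`Sign H_t(P′/P) = #roots_ℝ`), `sigPos_sub_sigNeg_hankelSq_dualSeq_mul_derivative_real`; N148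
`dualSeq_eq_dualSeq_mul_mul_derivative`; Literature `TarskiQuery.tarskiQuery_eq_cauchyIndex`, `cauchyIndex_mod`; Literature `SignDetermination.rootsIn` (`= roots.toFinset.filter (a < · < b)`),
`tarskiQuery_eq_taq`, `taq_one`, `cPos`, `cNeg`; Mathlib `eval_mul`, `eval_sub`, `eval_X`, `eval_C`, `mul_pos_iff`, `Finset.filter_congr`, `Finset.filter_true_of_mem`.
THIS FILE (namespace `Summit.Ventures.HSemireg.Wedge.HankelOuter` continued; CHAINED on N153 + N148; 0 definitions):
* §780 THE INTERVAL (`α ≤ β`): `eval_window_pos_iff` (`((X − α)(β − X))(x) > 0 ⟺ α < x < β`), `eval_window_ne_zero_iff`, **`two_mul_card_roots_filter_mem_Ioo_eq`**, **`two_mul_card_roots_filter_mem_Ioo_eq_of_eval_ne_zero`**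
  (`P(α), P(β) ≠ 0`: `2·#{α < x < β} = #roots_ℝ + Sign H_t(WP′/P)`), `two_mul_card_rootsIn_eq` (the same for Literature's `rootsIn P α β`), **`two_mul_tarskiQuery_one_eq`** (`2·TaQ(1, P; α, β) = Sign H_t(P′/P)
  + Sign H_t(WP′/P)`, `P(α)P(β) ≠ 0`).
* §782 WINDOWED HERMITE = WINDOWED STURM–TARSKI (any `Q`, `α ≤ β`, `P(α)P(β) ≠ 0`): `tarskiQuery_eq_sum_filter_sign`, `sum_sign_mul_add_sum_sign_eq`, **`two_mul_tarskiQuery_eq`** (`2·TaQ(Q, P; α, β) =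
  Sign H_t(QP′/P) + Sign H_t(WQP′/P)`), `two_mul_cauchyIndex_derivative_mul_eq` (`2·Ind(P′Q/P; α, β) = …`), **`two_mul_cauchyIndex_eq_of_separable`** (separable `P`, ANY numerator: `2·Ind(Q/P; α, β) =
  Sign H_t(Q/P) + Sign H_t(WQ/P)` — the windowed Hermite–Hurwitz theorem, N148).
* §781 HALF-LINES: **`two_mul_card_roots_filter_lt_eq`** (`W = X − α`: `2·#{x > α} = Sign H_t(W²P′/P) + Sign H_t(WP′/P)`), `two_mul_card_roots_filter_lt_eq_of_eval_ne_zero` (`P(α) ≠ 0`: `= #roots_ℝ +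
  Sign H_t((X − α)P′/P)`), `two_mul_card_roots_filter_gt_eq_of_eval_ne_zero` (`2·#{x < α} = #roots_ℝ − Sign H_t((X − α)P′/P)`).
CAVEATS.  `P` MONIC real, `deg P ≤ t + 1`; roots counted WITHOUT multiplicity; `α ≤ β` IS assumed in §780 (for `β < α` the multiplier `(X − α)(β − X)` is positive on `(β, α)` instead).
Nothing Ext-side.  New names only.
-/

open Module Polynomial
open scoped Matrix Polynomial

namespace Summit.Ventures.HSemireg.Wedge.HankelOuter

open Summit.Ventures.HSemireg.Wedge Summit.Ventures.HSemireg.Wedge.Hankel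
open Literature.Algebra.Polynomial (tarskiQuery cauchyIndex)
open Literature.Algebra.Polynomial.SignDetermination (taq cPos cNeg rootsIn tarskiQuery_eq_taq taq_one)

/-! ## §780. Roots in an open interval `(α, β)` -/

/-- `((X − α)(β − X))(x) > 0 ⟺ α < x < β` for `α ≤ β` (for `β < α` the positivity set would be `(β, α)`). [bookkeeping] -/
theorem eval_window_pos_iff {α β : ℝ} (hαβ : α ≤ β) (x : ℝ) : 0 < ((Polynomial.X - C α) * (C β - Polynomial.X)).eval x ↔ α < x ∧ x < β := by
  rw [eval_mul, eval_sub, eval_sub, eval_X, eval_C, eval_C, mul_pos_iff]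
  constructor
  · rintro (⟨h1, h2⟩ | ⟨h1, h2⟩)
    · exact ⟨by linarith, by linarith⟩
    · exact absurd hαβ (not_le.2 (by linarith))
  · rintro ⟨h1, h2⟩
    exact Or.inl ⟨by linarith, by linarith⟩

/-- `((X − α)(β − X))(x) ≠ 0 ⟺ x ≠ α ∧ x ≠ β`. [bookkeeping] -/
theorem eval_window_ne_zero_iff (α β x : ℝ) : ((Polynomial.X - C α) * (C β - Polynomial.X)).eval x ≠ 0 ↔ x ≠ α ∧ x ≠ β := by
  rw [eval_mul, eval_sub, eval_sub, eval_X, eval_C, eval_C, mul_ne_zero_iff, sub_ne_zero, sub_ne_zero, ne_comm (a := β)]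

/-- **HERMITE'S INTERVAL COUNT: `2·#{x ∈ roots_ℝ P | α < x < β} = Sign H_t(W²P′/P) + Sign H_t(WP′/P)`, `W = (X − α)(β − X)`** (`P` monic real, `deg P ≤ t + 1`, any `α`, `β`). [this file, §780] -/
theorem two_mul_card_roots_filter_mem_Ioo_eq {t : ℕ} {P : ℝ[X]} (hP : P.Monic) (hPd : P.natDegree ≤ t + 1) {α β : ℝ} (hαβ : α ≤ β) :
    2 * ((P.roots.toFinset.filter fun x => α < x ∧ x < β).card : ℤ)
      = ((sigPos (hankelSq ℝ t (dualSeq ℝ P (((Polynomial.X - C α) * (C β - Polynomial.X)) ^ 2 * derivative P))).toQuadraticForm' : ℤ)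
          - sigNeg (hankelSq ℝ t (dualSeq ℝ P (((Polynomial.X - C α) * (C β - Polynomial.X)) ^ 2 * derivative P))).toQuadraticForm')
        + ((sigPos (hankelSq ℝ t (dualSeq ℝ P ((Polynomial.X - C α) * (C β - Polynomial.X) * derivative P))).toQuadraticForm' : ℤ)
          - sigNeg (hankelSq ℝ t (dualSeq ℝ P ((Polynomial.X - C α) * (C β - Polynomial.X) * derivative P))).toQuadraticForm') := by
  rw [← two_mul_card_roots_filter_eval_pos_eq hP hPd ((Polynomial.X - C α) * (C β - Polynomial.X)), Finset.filter_congr fun x _ => (eval_window_pos_iff hαβ x).symm]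

/-- **… when `P(α) ≠ 0` and `P(β) ≠ 0`: `2·#{x ∈ roots_ℝ P | α < x < β} = #roots_ℝ(P) + Sign H_t(WP′/P)`** (then `W ≠ 0` at every root, so `Sign H_t(W²P′/P) = #roots_ℝ(P)`). [this file, §780] -/
theorem two_mul_card_roots_filter_mem_Ioo_eq_of_eval_ne_zero {t : ℕ} {P : ℝ[X]} (hP : P.Monic) (hPd : P.natDegree ≤ t + 1) {α β : ℝ} (hαβ : α ≤ β) (hα : P.eval α ≠ 0) (hβ : P.eval β ≠ 0) :
    2 * ((P.roots.toFinset.filter fun x => α < x ∧ x < β).card : ℤ)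
      = (P.roots.toFinset.card : ℤ)
        + ((sigPos (hankelSq ℝ t (dualSeq ℝ P ((Polynomial.X - C α) * (C β - Polynomial.X) * derivative P))).toQuadraticForm' : ℤ)
          - sigNeg (hankelSq ℝ t (dualSeq ℝ P ((Polynomial.X - C α) * (C β - Polynomial.X) * derivative P))).toQuadraticForm') := by
  have hW : (P.roots.toFinset.filter fun x => ((Polynomial.X - C α) * (C β - Polynomial.X)).eval x ≠ 0) = P.roots.toFinset :=
    Finset.filter_true_of_mem fun x hx => (eval_window_ne_zero_iff α β x).2
      ⟨fun h => hα (by rw [← h]; exact (mem_roots hP.ne_zero).1 (Multiset.mem_toFinset.1 hx)), fun h => hβ (by rw [← h]; exact (mem_roots hP.ne_zero).1 (Multiset.mem_toFinset.1 hx))⟩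
  rw [two_mul_card_roots_filter_mem_Ioo_eq hP hPd hαβ, sigPos_sub_sigNeg_hankelSq_dualSeq_sq_mul_derivative_eq hP hPd, ← Nat.cast_add, ← card_roots_filter_eval_ne_zero_eq, hW]

/-- **… for the tree's `rootsIn P α β`** (Literature `SignDetermination`: the roots of `P` in `(α, β)`). [this file, §780] -/
theorem two_mul_card_rootsIn_eq {t : ℕ} {P : ℝ[X]} (hP : P.Monic) (hPd : P.natDegree ≤ t + 1) {α β : ℝ} (hαβ : α ≤ β) (hα : P.eval α ≠ 0) (hβ : P.eval β ≠ 0) :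
    2 * ((rootsIn P α β).card : ℤ)
      = (P.roots.toFinset.card : ℤ)
        + ((sigPos (hankelSq ℝ t (dualSeq ℝ P ((Polynomial.X - C α) * (C β - Polynomial.X) * derivative P))).toQuadraticForm' : ℤ)
          - sigNeg (hankelSq ℝ t (dualSeq ℝ P ((Polynomial.X - C α) * (C β - Polynomial.X) * derivative P))).toQuadraticForm') :=
  two_mul_card_roots_filter_mem_Ioo_eq_of_eval_ne_zero hP hPd hαβ hα hβ

/-- **HERMITE = STURM–TARSKI ON A WINDOW: `2·TaQ(1, P; α, β) = Sign H_t(P′/P) + Sign H_t(WP′/P)`, `W = (X − α)(β − X)`** for `P` monic real, `deg P ≤ t + 1`, `P(α)P(β) ≠ 0` (`TaQ(1, P; α, β)` is the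
number of roots in `(α, β)`; `Sign H_t(P′/P) = #roots_ℝ(P)`, N129). [this file, §780] -/
theorem two_mul_tarskiQuery_one_eq {t : ℕ} {P : ℝ[X]} (hP : P.Monic) (hPd : P.natDegree ≤ t + 1) {α β : ℝ} (hαβ : α ≤ β) (hα : P.eval α ≠ 0) (hβ : P.eval β ≠ 0) :
    2 * tarskiQuery 1 P α β
      = ((sigPos (hankelSq ℝ t (dualSeq ℝ P (derivative P))).toQuadraticForm' : ℤ) - sigNeg (hankelSq ℝ t (dualSeq ℝ P (derivative P))).toQuadraticForm')
        + ((sigPos (hankelSq ℝ t (dualSeq ℝ P ((Polynomial.X - C α) * (C β - Polynomial.X) * derivative P))).toQuadraticForm' : ℤ)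
          - sigNeg (hankelSq ℝ t (dualSeq ℝ P ((Polynomial.X - C α) * (C β - Polynomial.X) * derivative P))).toQuadraticForm') := by
  rw [tarskiQuery_eq_taq, show (fun x : ℝ => (1 : ℝ[X]).eval x) = fun _ => (1 : ℝ) from funext fun x => eval_one, taq_one, sigPos_sub_sigNeg_hankelSq_dualSeq_derivative_real hP hPd]
  exact two_mul_card_rootsIn_eq hP hPd hαβ hα hβ

/-! ## §781. Roots on a half-line -/

/-- **`2·#{x ∈ roots_ℝ P | α < x} = Sign H_t((X − α)²P′/P) + Sign H_t((X − α)P′/P)`** (`P` monic real, `deg P ≤ t + 1`, any `α`). [this file, §781] -/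
theorem two_mul_card_roots_filter_lt_eq {t : ℕ} {P : ℝ[X]} (hP : P.Monic) (hPd : P.natDegree ≤ t + 1) (α : ℝ) :
    2 * ((P.roots.toFinset.filter fun x => α < x).card : ℤ)
      = ((sigPos (hankelSq ℝ t (dualSeq ℝ P ((Polynomial.X - C α) ^ 2 * derivative P))).toQuadraticForm' : ℤ) - sigNeg (hankelSq ℝ t (dualSeq ℝ P ((Polynomial.X - C α) ^ 2 * derivative P))).toQuadraticForm')
        + ((sigPos (hankelSq ℝ t (dualSeq ℝ P ((Polynomial.X - C α) * derivative P))).toQuadraticForm' : ℤ) - sigNeg (hankelSq ℝ t (dualSeq ℝ P ((Polynomial.X - C α) * derivative P))).toQuadraticForm') := by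
  have hfilter : (P.roots.toFinset.filter fun x => 0 < (Polynomial.X - C α).eval x) = P.roots.toFinset.filter fun x => α < x :=
    Finset.filter_congr fun x _ => by rw [eval_sub, eval_X, eval_C, sub_pos]
  rw [← two_mul_card_roots_filter_eval_pos_eq hP hPd (Polynomial.X - C α), hfilter]

/-- **… when `P(α) ≠ 0`: `2·#{x ∈ roots_ℝ P | α < x} = #roots_ℝ(P) + Sign H_t((X − α)P′/P)`.** [this file, §781] -/
theorem two_mul_card_roots_filter_lt_eq_of_eval_ne_zero {t : ℕ} {P : ℝ[X]} (hP : P.Monic) (hPd : P.natDegree ≤ t + 1) {α : ℝ} (hα : P.eval α ≠ 0) :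
    2 * ((P.roots.toFinset.filter fun x => α < x).card : ℤ)
      = (P.roots.toFinset.card : ℤ)
        + ((sigPos (hankelSq ℝ t (dualSeq ℝ P ((Polynomial.X - C α) * derivative P))).toQuadraticForm' : ℤ) - sigNeg (hankelSq ℝ t (dualSeq ℝ P ((Polynomial.X - C α) * derivative P))).toQuadraticForm') := by
  have hW : (P.roots.toFinset.filter fun x => (Polynomial.X - C α).eval x ≠ 0) = P.roots.toFinset :=
    Finset.filter_true_of_mem fun x hx => by
      rw [eval_sub, eval_X, eval_C, sub_ne_zero]
      exact fun h => hα (by rw [← h]; exact (mem_roots hP.ne_zero).1 (Multiset.mem_toFinset.1 hx))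
  rw [two_mul_card_roots_filter_lt_eq hP hPd α, sigPos_sub_sigNeg_hankelSq_dualSeq_sq_mul_derivative_eq hP hPd, ← Nat.cast_add, ← card_roots_filter_eval_ne_zero_eq, hW]

/-- **… and `2·#{x ∈ roots_ℝ P | x < α} = #roots_ℝ(P) − Sign H_t((X − α)P′/P)` when `P(α) ≠ 0`** (N153's count of `#{Q < 0}` with `Q = X − α`). [this file, §781] -/
theorem two_mul_card_roots_filter_gt_eq_of_eval_ne_zero {t : ℕ} {P : ℝ[X]} (hP : P.Monic) (hPd : P.natDegree ≤ t + 1) {α : ℝ} (hα : P.eval α ≠ 0) :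
    2 * ((P.roots.toFinset.filter fun x => x < α).card : ℤ)
      = (P.roots.toFinset.card : ℤ)
        - (((sigPos (hankelSq ℝ t (dualSeq ℝ P ((Polynomial.X - C α) * derivative P))).toQuadraticForm' : ℤ) - sigNeg (hankelSq ℝ t (dualSeq ℝ P ((Polynomial.X - C α) * derivative P))).toQuadraticForm')) := by
  have hW : (P.roots.toFinset.filter fun x => (Polynomial.X - C α).eval x ≠ 0) = P.roots.toFinset :=
    Finset.filter_true_of_mem fun x hx => by
      rw [eval_sub, eval_X, eval_C, sub_ne_zero]
      exact fun h => hα (by rw [← h]; exact (mem_roots hP.ne_zero).1 (Multiset.mem_toFinset.1 hx))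
  have hfilter : (P.roots.toFinset.filter fun x => (Polynomial.X - C α).eval x < 0) = P.roots.toFinset.filter fun x => x < α :=
    Finset.filter_congr fun x _ => by rw [eval_sub, eval_X, eval_C, sub_neg]
  have h := two_mul_card_roots_filter_eval_neg_eq hP hPd (Polynomial.X - C α)
  rw [hfilter, sigPos_sub_sigNeg_hankelSq_dualSeq_sq_mul_derivative_eq hP hPd, ← Nat.cast_add, ← card_roots_filter_eval_ne_zero_eq, hW] at h
  exact h

/-! ## §782. Windowed Hermite = windowed Sturm–Tarski: `2·TaQ(Q, P; α, β) = Sign H_t(QP′/P) + Sign H_t(WQP′/P)` and, for separable `P`, `2·Ind(Q/P; α, β) = Sign H_t(Q/P) + Sign H_t(WQ/P)` -/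

/-- The tree's `tarskiQuery Q P a b` is `Σ_{x ∈ roots_ℝ P, a < x < b} sign Q(x)` (its definition, with the `if`s rewritten as `SignType.sign`). [bookkeeping; BPR Notation 2.56] -/
theorem tarskiQuery_eq_sum_filter_sign (P Q : ℝ[X]) (a b : ℝ) : tarskiQuery Q P a b = ∑ x ∈ P.roots.toFinset.filter (fun x => a < x ∧ x < b), (SignType.sign (Q.eval x) : ℤ) := by
  unfold tarskiQuery
  refine Finset.sum_congr rfl fun x _ => ?_
  rcases lt_trichotomy 0 (Q.eval x) with h | h | h
  · rw [if_pos h, sign_pos h, SignType.coe_one]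
  · rw [if_neg (by rw [← h]; exact lt_irrefl 0), if_neg (by rw [← h]; exact lt_irrefl 0), ← h, sign_zero, SignType.coe_zero]
  · rw [if_neg (not_lt.2 h.le), if_pos h, sign_neg h, SignType.coe_neg_one]

/-- `Σ_{x ∈ S} sign(W(x) f(x)) + Σ_{x ∈ S} sign f(x) = 2·Σ_{x ∈ S, W(x) > 0} sign f(x)` when `W ≠ 0` on `S` (each term is `2 sign f(x)` or `0`). [bookkeeping] -/
theorem sum_sign_mul_add_sum_sign_eq {ι : Type*} (S : Finset ι) (W f : ι → ℝ) (hW : ∀ x ∈ S, W x ≠ 0) :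
    ∑ x ∈ S, (SignType.sign (W x * f x) : ℤ) + ∑ x ∈ S, (SignType.sign (f x) : ℤ) = 2 * ∑ x ∈ S.filter (fun x => 0 < W x), (SignType.sign (f x) : ℤ) := by
  classical
  rw [← Finset.sum_add_distrib, Finset.sum_filter, Finset.mul_sum]
  refine Finset.sum_congr rfl fun x hx => ?_
  rw [sign_mul, SignType.coe_mul]
  rcases (hW x hx).lt_or_gt with h | h
  · rw [sign_neg h, if_neg (not_lt.2 h.le), SignType.coe_neg_one]; ring
  · rw [sign_pos h, if_pos h, SignType.coe_one]; ring

/-- **WINDOWED HERMITE = WINDOWED STURM–TARSKI: `2·TaQ(Q, P; α, β) = Sign H_t((Q·P′)/P) + Sign H_t(((W·Q)·P′)/P)`, `W = (X − α)(β − X)`** for `P` monic real, `deg P ≤ t + 1`, ANY `Q`, `α ≤ β`,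
`P(α)P(β) ≠ 0` (N129's `Sign H_t((Q·P′)/P) = Σ_x sign Q(x)` for `Q` and `W·Q`; the tree's `tarskiQuery` is the windowed sum). [this file, §782] -/
theorem two_mul_tarskiQuery_eq {t : ℕ} {P : ℝ[X]} (hP : P.Monic) (hPd : P.natDegree ≤ t + 1) (Q : ℝ[X]) {α β : ℝ} (hαβ : α ≤ β) (hα : P.eval α ≠ 0) (hβ : P.eval β ≠ 0) :
    2 * tarskiQuery Q P α β
      = ((sigPos (hankelSq ℝ t (dualSeq ℝ P (Q * derivative P))).toQuadraticForm' : ℤ) - sigNeg (hankelSq ℝ t (dualSeq ℝ P (Q * derivative P))).toQuadraticForm')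
        + ((sigPos (hankelSq ℝ t (dualSeq ℝ P ((Polynomial.X - C α) * (C β - Polynomial.X) * Q * derivative P))).toQuadraticForm' : ℤ)
          - sigNeg (hankelSq ℝ t (dualSeq ℝ P ((Polynomial.X - C α) * (C β - Polynomial.X) * Q * derivative P))).toQuadraticForm') := by
  have hW : ∀ x ∈ P.roots.toFinset, ((Polynomial.X - C α) * (C β - Polynomial.X)).eval x ≠ 0 := fun x hx => (eval_window_ne_zero_iff α β x).2
    ⟨fun h => hα (by rw [← h]; exact (mem_roots hP.ne_zero).1 (Multiset.mem_toFinset.1 hx)), fun h => hβ (by rw [← h]; exact (mem_roots hP.ne_zero).1 (Multiset.mem_toFinset.1 hx))⟩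
  rw [sigPos_sub_sigNeg_hankelSq_dualSeq_mul_derivative_real hP hPd Q, sigPos_sub_sigNeg_hankelSq_dualSeq_mul_derivative_real hP hPd ((Polynomial.X - C α) * (C β - Polynomial.X) * Q),
    tarskiQuery_eq_sum_filter_sign, Finset.filter_congr fun x _ => (eval_window_pos_iff hαβ x).symm, add_comm]
  simp only [eval_mul]
  exact (sum_sign_mul_add_sum_sign_eq P.roots.toFinset (fun x => (Polynomial.X - C α).eval x * (C β - Polynomial.X).eval x) (fun x => Q.eval x)
    (fun x hx => by rw [← eval_mul]; exact hW x hx)).symm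

/-- **… equivalently with the Cauchy index of `P′Q/P`: `2·Ind(P′Q/P; α, β) = Sign H_t((Q·P′)/P) + Sign H_t(((W·Q)·P′)/P)`** (Literature `tarskiQuery_eq_cauchyIndex`, BPR Prop. 2.57). [this file, §782] -/
theorem two_mul_cauchyIndex_derivative_mul_eq {t : ℕ} {P : ℝ[X]} (hP : P.Monic) (hPd : P.natDegree ≤ t + 1) (Q : ℝ[X]) {α β : ℝ} (hαβ : α ≤ β) (hα : P.eval α ≠ 0) (hβ : P.eval β ≠ 0) :
    2 * cauchyIndex P (derivative P * Q) α β
      = ((sigPos (hankelSq ℝ t (dualSeq ℝ P (Q * derivative P))).toQuadraticForm' : ℤ) - sigNeg (hankelSq ℝ t (dualSeq ℝ P (Q * derivative P))).toQuadraticForm')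
        + ((sigPos (hankelSq ℝ t (dualSeq ℝ P ((Polynomial.X - C α) * (C β - Polynomial.X) * Q * derivative P))).toQuadraticForm' : ℤ)
          - sigNeg (hankelSq ℝ t (dualSeq ℝ P ((Polynomial.X - C α) * (C β - Polynomial.X) * Q * derivative P))).toQuadraticForm') := by
  rw [← Literature.Algebra.Polynomial.tarskiQuery_eq_cauchyIndex Q P hP.ne_zero, two_mul_tarskiQuery_eq hP hPd Q hαβ hα hβ]

/-- **WINDOWED HERMITE–HURWITZ for separable `P`: `2·Ind(Q/P; α, β) = Sign H_t(Q/P) + Sign H_t((W·Q)/P)`, `W = (X − α)(β − X)`** for `P` monic real SEPARABLE, `deg P ≤ t + 1`, ANY numerator `Q`,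
`α ≤ β`, `P(α)P(β) ≠ 0` (N148: `Q ≡ (Q v)·P′ mod P` with `u P + v P′ = 1`, so both sides reduce to the previous statement for the multiplier `Q v`). [this file, §782] -/
theorem two_mul_cauchyIndex_eq_of_separable {t : ℕ} {P : ℝ[X]} (hP : P.Monic) (hsep : P.Separable) (hPd : P.natDegree ≤ t + 1) (Q : ℝ[X]) {α β : ℝ} (hαβ : α ≤ β) (hα : P.eval α ≠ 0)
    (hβ : P.eval β ≠ 0) :
    2 * cauchyIndex P Q α β
      = ((sigPos (hankelSq ℝ t (dualSeq ℝ P Q)).toQuadraticForm' : ℤ) - sigNeg (hankelSq ℝ t (dualSeq ℝ P Q)).toQuadraticForm')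
        + ((sigPos (hankelSq ℝ t (dualSeq ℝ P ((Polynomial.X - C α) * (C β - Polynomial.X) * Q))).toQuadraticForm' : ℤ)
          - sigNeg (hankelSq ℝ t (dualSeq ℝ P ((Polynomial.X - C α) * (C β - Polynomial.X) * Q))).toQuadraticForm') := by
  obtain ⟨u, v, huv⟩ := (Polynomial.separable_def P).1 hsep
  have hmod : Q % P = (derivative P * (Q * v)) % P := by
    rw [← Polynomial.modByMonic_eq_mod Q hP, ← Polynomial.modByMonic_eq_mod _ hP]
    exact Polynomial.modByMonic_eq_of_dvd_sub hP ⟨Q * u, by linear_combination (-Q) * huv⟩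
  rw [dualSeq_eq_dualSeq_mul_mul_derivative hP huv Q, dualSeq_eq_dualSeq_mul_mul_derivative hP huv ((Polynomial.X - C α) * (C β - Polynomial.X) * Q),
    ← Literature.Algebra.Polynomial.cauchyIndex_mod P Q, hmod, Literature.Algebra.Polynomial.cauchyIndex_mod, two_mul_cauchyIndex_derivative_mul_eq hP hPd (Q * v) hαβ hα hβ, ← mul_assoc]

end Summit.Ventures.HSemireg.Wedge.HankelOuter
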